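import Literature.NumberTheory.Automorphic.HarishChandraGL
import Literature.NumberTheory.Automorphic.HarishChandraGLEmbeddings
import Literature.NumberTheory.Automorphic.HarishChandraCore
import Mathlib.RingTheory.TensorProduct.Free
import Mathlib.RingTheory.Flat.Basic
import Mathlib.LinearAlgebra.Complex.Module
import Mathlib.LinearAlgebra.FreeModule.Basic
import Mathlib.SetTheory.Cardinal.Order
import HarnessLib

/-!
# Harish-Chandra's isomorphism for `𝔤𝔩ₙ(𝕜)`: proof of `harishChandraHomGL_bijective_symmetric`

`𝕜` is `ℝ` or `ℂ` (`RCLike 𝕜`), `𝔤 = 𝔤𝔩ₙ(𝕜)` as a *real* Lie algebra, `U(𝔤)` its real universal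
enveloping algebra with centre `Z(𝔤)`, and `T = (𝕜 →ₐ[ℝ] ℂ)` the real algebra embeddings of `𝕜`
into `ℂ` (one for `𝕜 = ℝ`, two for `𝕜 = ℂ`). This file proves the named fact
`Literature.NumberTheory.Automorphic.harishChandraHomGL_bijective_symmetric` of `HarishChandraGL`
(`harishChandraHomGL_bijective_symmetric_holds`): for every Harish-Chandra homomorphism
`γ : Z(𝔤) →ₐ[ℝ] ℂ[x_{τ,i}]` (structure `HarishChandraHomGL`: `τ`-wise symmetric values computing
the action of `Z(𝔤)` on highest weight vectors at `λ + ρ`), the `ℂ`-linear extension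
`ℂ ⊗_ℝ Z(𝔤) → ℂ[x_{τ,i}]` is injective with range the `∏_τ 𝔖ₙ`-symmetric polynomials.

## Proof

* *Complexification of the Lie algebra* (`embAlgHom`, `embBasis`): the map
  `j : 𝔤𝔩ₙ(𝕜) → 𝔤_ℂ := ∏_{τ ∈ T} 𝔤𝔩ₙ(ℂ)`, `X ↦ (τ X)_τ`, sends every real basis of `𝔤𝔩ₙ(𝕜)`
  to a complex basis of `𝔤_ℂ` (the embeddings separate `𝕜 ⊗_ℝ ℂ ≅ ℂ^T`;
  `HarishChandraGLEmbeddings`).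
* *Complexification of the enveloping algebra* (`envHomC_bijective`): by the
  Poincaré–Birkhoff–Witt theorem (`Literature.Algebra.Lie.PBW.pbwBasis`, file `PoincareBirkhoffWitt`) the induced
  map `Φ_ℂ : ℂ ⊗_ℝ U(𝔤) → U(𝔤_ℂ)` sends the complexified PBW basis to a PBW basis, so it is an
  isomorphism of complex algebras.
* *Centres* (`centerEquiv`): `ℂ` is flat over `ℝ` and a central element of `ℂ ⊗_ℝ U(𝔤)` is
  `1 ⊗ X + i ⊗ Y` with `X, Y` central, so `Φ_ℂ` restricts to `Θ : ℂ ⊗_ℝ Z(𝔤) ≃ Z(U(𝔤_ℂ))`.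
* *Highest weight property on the complex side* (`hasHWProperty_complexified`): a complex
  representation of `𝔤_ℂ` restricts along `j` to a real representation of `𝔤𝔩ₙ(𝕜)` on the same
  complex space with the same highest weight vectors (`isHighestWeightVector_resRep`), and
  `U(𝔤)` acts through `Φ` (`lift_resRep`); hence `γ' := γ_ℂ ∘ Θ⁻¹` has the highest weight
  property of `HarishChandraCore` with shift `ρ`, and symmetric values.
* *Conclusion*: the complex core theorem `HCCore.injective_and_range_eq_of_hasHWProperty`
  (file `HarishChandraCore`: Harish-Chandra projection, Chevalley restriction injectivity,
  Casimir surjectivity) gives injectivity and the range of `γ'`, which transfer to `γ_ℂ` along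
  `Θ` (`baseChange_injective_and_range_eq`), and `γ_ℂ` is `liftBaseChange ℂ γ` as a linear map
  (`harishChandraHomGL_bijective_symmetric_iff`).

## References

* A. W. Knapp, *Lie Groups Beyond an Introduction*, 2nd ed., Birkhäuser 2002, §V.5 Thm. 5.44,
  §VI.1 (complexifications).
* N. Bourbaki, *Lie Groups and Lie Algebras*, Ch. I §2.9 (extension of the base ring:
  `U(𝔤_{(K₁)}) = U(𝔤)_{(K₁)}`).
* A. W. Knapp, D. A. Vogan, *Cohomological Induction and Unitary Representations*, 1995, §IV.7,
  Thm. 4.95.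
* J. E. Humphreys, *Introduction to Lie Algebras and Representation Theory*, 1972, §17.3, §23.3.
-/

-- Mathlib idiom (Mathlib/Algebra/Lie/OfAssociative.lean): the commutator bracket on associative rings
attribute [local instance 100] LieRing.ofAssociativeRing

open scoped TensorProduct ComplexConjugate

noncomputable section

namespace Literature.NumberTheory.Automorphic

open UniversalEnvelopingAlgebra HCEmb RCLike

variable {𝕜 : Type*} [RCLike 𝕜] {n : ℕ}

/-! ### The embeddings `j : 𝔤𝔩ₙ(𝕜) → ∏_τ 𝔤𝔩ₙ(ℂ)` and the complexification of `𝔤𝔩ₙ(𝕜)` -/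

section Embedding

variable (𝕜 n)

/-- The real algebra homomorphism `j : 𝔤𝔩ₙ(𝕜) → ∏_{τ : 𝕜 →ₐ[ℝ] ℂ} 𝔤𝔩ₙ(ℂ)`, `X ↦ (τ(X))_τ`
(entrywise); its complexification is an isomorphism `𝔤𝔩ₙ(𝕜) ⊗_ℝ ℂ ≅ ∏_τ 𝔤𝔩ₙ(ℂ)`
(Knapp 2002, §VI.1; Clozel 1990, §3.3). [folklore] -/
def embAlgHom : Matrix (Fin n) (Fin n) 𝕜 →ₐ[ℝ] ((𝕜 →ₐ[ℝ] ℂ) → Matrix (Fin n) (Fin n) ℂ) :=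
  AlgHom.pi fun τ ↦ (τ : 𝕜 →ₐ[ℝ] ℂ).mapMatrix

variable {𝕜 n}

/-- Entries of `j(X)`: `j(X)_τ = τ(X)` entrywise. [folklore] -/
@[simp]
theorem embAlgHom_apply (X : Matrix (Fin n) (Fin n) 𝕜) (τ : 𝕜 →ₐ[ℝ] ℂ) (a b : Fin n) :
    embAlgHom 𝕜 n X τ a b = τ (X a b) := rfl

/-- `j(X) + i · j(Y) = 0` forces `X = Y = 0`: the embeddings `τ` separate `𝕜 ⊗_ℝ ℂ`. [folklore] -/
theorem eq_zero_of_emb_add_I_smul_emb_eq_zero {X Y : Matrix (Fin n) (Fin n) 𝕜}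
    (h : (embAlgHom 𝕜 n X : (𝕜 →ₐ[ℝ] ℂ) → Matrix (Fin n) (Fin n) ℂ) + Complex.I • embAlgHom 𝕜 n Y = 0) :
    X = 0 ∧ Y = 0 := by
  have hab : ∀ a b : Fin n, X a b = 0 ∧ Y a b = 0 := by
    intro a b
    set x := X a b
    set y := Y a b
    have hτ : ∀ τ : 𝕜 →ₐ[ℝ] ℂ, τ x + Complex.I * τ y = 0 := fun τ ↦ by
      have := congrFun (congrFun (congrFun h τ) a) b
      simpa using this
    have hs := card_algHom_ne_zero (𝕜 := 𝕜)
    -- sum over `τ`: real parts vanish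
    have hA : ∀ p q : ℂ, ∑ τ : 𝕜 →ₐ[ℝ] ℂ, (p + q * τ I) = (Fintype.card (𝕜 →ₐ[ℝ] ℂ) : ℂ) * p := by
      intro p q
      rw [Finset.sum_add_distrib, Finset.sum_const, Finset.card_univ, ← Finset.mul_sum, sum_algHom_I, mul_zero,
        add_zero, nsmul_eq_mul]
    have h1 : (re x : ℂ) + Complex.I * (re y : ℂ) = 0 := by
      have hsum : ∑ τ : 𝕜 →ₐ[ℝ] ℂ, (τ x + Complex.I * τ y) = 0 := Finset.sum_eq_zero fun τ _ ↦ hτ τ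
      simp_rw [algHom_apply_eq _ x, algHom_apply_eq _ y] at hsum
      rw [Finset.sum_add_distrib, ← Finset.mul_sum, hA, hA, ← mul_assoc, mul_comm Complex.I, mul_assoc,
        ← mul_add] at hsum
      exact (mul_eq_zero.mp hsum).resolve_left hs
    have hre : re x = 0 ∧ re y = 0 := by
      have := Complex.ext_iff.mp h1
      simp at this
      exact ⟨this.1, this.2⟩
    rcases RCLike.I_eq_zero_or_im_I_eq_one (K := 𝕜) with h0 | h0
    · have hx : x = re x := by
        conv_lhs => rw [← re_add_im x, RCLike.im_eq_zero h0, RCLike.ofReal_zero, zero_mul, add_zero]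
      have hy : y = re y := by
        conv_lhs => rw [← re_add_im y, RCLike.im_eq_zero h0, RCLike.ofReal_zero, zero_mul, add_zero]
      rw [hx, hy, hre.1, hre.2, RCLike.ofReal_zero]
      exact ⟨rfl, rfl⟩
    · have hI0 : (I : 𝕜) ≠ 0 := fun h' ↦ by simp [h'] at h0
      -- multiply by `conj (τ I)` and sum: imaginary parts vanish
      have h2 : (im x : ℂ) + Complex.I * (im y : ℂ) = 0 := by
        have hsum : ∑ τ : 𝕜 →ₐ[ℝ] ℂ, conj (τ I) * (τ x + Complex.I * τ y) = 0 :=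
          Finset.sum_eq_zero fun τ _ ↦ by rw [hτ τ, mul_zero]
        have e : ∀ τ : 𝕜 →ₐ[ℝ] ℂ, conj (τ I) * (τ x + Complex.I * τ y) =
            (re x + Complex.I * re y) * conj (τ I) + ((im x : ℂ) + Complex.I * im y) := by
          intro τ
          rw [algHom_apply_eq τ x, algHom_apply_eq τ y]
          have := conj_algHom_I_mul_self τ hI0
          linear_combination ((im x : ℂ) + Complex.I * im y) * this
        simp_rw [e] at hsum
        rw [Finset.sum_add_distrib, ← Finset.mul_sum, ← map_sum, sum_algHom_I, map_zero, mul_zero, zero_add,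
          Finset.sum_const, Finset.card_univ, nsmul_eq_mul] at hsum
        exact (mul_eq_zero.mp hsum).resolve_left hs
      have him : im x = 0 ∧ im y = 0 := by
        have := Complex.ext_iff.mp h2
        simp at this
        exact ⟨this.1, this.2⟩
      constructor
      · rw [← re_add_im x, hre.1, him.1]; simp
      · rw [← re_add_im y, hre.2, him.2]; simp
  exact ⟨Matrix.ext fun a b ↦ (hab a b).1, Matrix.ext fun a b ↦ (hab a b).2⟩

/-- The elementary tuples `(δ_{ττ'} E_{ab})_{τ'}` lie in the `ℂ`-span of `j(𝔤𝔩ₙ(𝕜))`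
(primitive idempotents of `𝕜 ⊗_ℝ ℂ`; `HCEmb.orthogonality`). [folklore] -/
theorem single_mem_span_emb [DecidableEq (𝕜 →ₐ[ℝ] ℂ)] (τ : 𝕜 →ₐ[ℝ] ℂ) (a b : Fin n) :
    (Pi.single τ (Matrix.single a b (1 : ℂ)) : (𝕜 →ₐ[ℝ] ℂ) → Matrix (Fin n) (Fin n) ℂ) ∈
      Submodule.span ℂ (Set.range (embAlgHom 𝕜 n)) := by
  have key : (Pi.single τ (Matrix.single a b (1 : ℂ)) : (𝕜 →ₐ[ℝ] ℂ) → Matrix (Fin n) (Fin n) ℂ) =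
      (Fintype.card (𝕜 →ₐ[ℝ] ℂ) : ℂ)⁻¹ • (embAlgHom 𝕜 n (Matrix.single a b (1 : 𝕜)) +
        conj (τ I) • embAlgHom 𝕜 n (Matrix.single a b (I : 𝕜))) := by
    funext τ'
    have hmap : ∀ z : 𝕜, embAlgHom 𝕜 n (Matrix.single a b z) τ' = τ' z • Matrix.single a b (1 : ℂ) := by
      intro z
      ext c d
      rw [embAlgHom_apply, Matrix.smul_apply, Matrix.single_apply, Matrix.single_apply]
      split_ifs <;> simp
    rw [Pi.single_apply, Pi.smul_apply, Pi.add_apply, Pi.smul_apply, hmap, hmap, map_one, one_smul, smul_smul]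
    have e : (Matrix.single a b (1 : ℂ) : Matrix (Fin n) (Fin n) ℂ) + (conj (τ I) * τ' I) • Matrix.single a b 1 =
        (1 + conj (τ I) * τ' I) • Matrix.single a b 1 := by rw [add_smul, one_smul]
    rw [e, smul_smul, orthogonality τ τ']
    by_cases h : τ' = τ
    · subst h; simp
    · rw [if_neg h, if_neg (Ne.symm h), zero_smul]
  rw [key]
  exact Submodule.smul_mem _ _ (add_mem (Submodule.subset_span ⟨_, rfl⟩)
    (Submodule.smul_mem _ _ (Submodule.subset_span ⟨_, rfl⟩)))

/-- **`j ∘ b` is `ℂ`-linearly independent** for every real basis `b` of `𝔤𝔩ₙ(𝕜)`. [folklore] -/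
theorem linearIndependent_emb_basis {ι : Type*} (b : Module.Basis ι ℝ (Matrix (Fin n) (Fin n) 𝕜)) :
    LinearIndependent ℂ fun i ↦ (embAlgHom 𝕜 n (b i) : (𝕜 →ₐ[ℝ] ℂ) → Matrix (Fin n) (Fin n) ℂ) := by
  classical
  rw [linearIndependent_iff']
  intro s c hc i hi
  have hsmul : ∀ (z : ℂ) (v : (𝕜 →ₐ[ℝ] ℂ) → Matrix (Fin n) (Fin n) ℂ), z • v = z.re • v + Complex.I • (z.im • v) := by
    intro z v
    conv_lhs => rw [← Complex.re_add_im z]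
    rw [add_smul, mul_comm, mul_smul, Complex.coe_smul, Complex.coe_smul]
  have hdecomp : ∑ i ∈ s, c i • (embAlgHom 𝕜 n (b i) : (𝕜 →ₐ[ℝ] ℂ) → Matrix (Fin n) (Fin n) ℂ) =
      embAlgHom 𝕜 n (∑ i ∈ s, (c i).re • b i) + Complex.I • embAlgHom 𝕜 n (∑ i ∈ s, (c i).im • b i) := by
    rw [map_sum, map_sum, Finset.smul_sum, ← Finset.sum_add_distrib]
    refine Finset.sum_congr rfl fun i _ ↦ ?_
    rw [map_smul, map_smul, hsmul]
  rw [hdecomp] at hc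
  obtain ⟨hre, him⟩ := eq_zero_of_emb_add_I_smul_emb_eq_zero hc
  have h1 := linearIndependent_iff'.mp b.linearIndependent s (fun i ↦ (c i).re) hre i hi
  have h2 := linearIndependent_iff'.mp b.linearIndependent s (fun i ↦ (c i).im) him i hi
  exact Complex.ext h1 h2

/-- **`j ∘ b` spans `∏_τ 𝔤𝔩ₙ(ℂ)` over `ℂ`** for every real basis `b` of `𝔤𝔩ₙ(𝕜)`. [folklore] -/
theorem span_emb_basis {ι : Type*} (b : Module.Basis ι ℝ (Matrix (Fin n) (Fin n) 𝕜)) :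
    ⊤ ≤ Submodule.span ℂ (Set.range fun i ↦ (embAlgHom 𝕜 n (b i) : (𝕜 →ₐ[ℝ] ℂ) → Matrix (Fin n) (Fin n) ℂ)) := by
  classical
  -- the span contains `j(X)` for every `X`
  have hj : ∀ X, (embAlgHom 𝕜 n X : (𝕜 →ₐ[ℝ] ℂ) → Matrix (Fin n) (Fin n) ℂ) ∈
      Submodule.span ℂ (Set.range fun i ↦ (embAlgHom 𝕜 n (b i) : (𝕜 →ₐ[ℝ] ℂ) → Matrix (Fin n) (Fin n) ℂ)) := by
    intro X
    rw [← b.linearCombination_repr X, Finsupp.linearCombination_apply, map_finsuppSum]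
    refine Submodule.finsuppSum_mem _ _ _ _ fun i _ ↦ ?_
    rw [map_smul, ← Complex.coe_smul]
    exact Submodule.smul_mem _ _ (Submodule.subset_span ⟨i, rfl⟩)
  have hrange : Submodule.span ℂ (Set.range (embAlgHom 𝕜 n)) ≤
      Submodule.span ℂ (Set.range fun i ↦ (embAlgHom 𝕜 n (b i) : (𝕜 →ₐ[ℝ] ℂ) → Matrix (Fin n) (Fin n) ℂ)) :=
    Submodule.span_le.mpr (by rintro _ ⟨X, rfl⟩; exact hj X)
  intro Y _
  -- `Y = ∑ Y τ a b • (elementary tuples)`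
  have hY : Y = ∑ τ : 𝕜 →ₐ[ℝ] ℂ, ∑ a : Fin n, ∑ c : Fin n, Y τ a c •
      (Pi.single τ (Matrix.single a c (1 : ℂ)) : (𝕜 →ₐ[ℝ] ℂ) → Matrix (Fin n) (Fin n) ℂ) := by
    funext τ'
    simp only [Finset.sum_apply, Pi.smul_apply, Pi.single_apply, smul_ite, smul_zero]
    rw [Finset.sum_eq_single τ' (fun τ _ hτ ↦ by simp [Ne.symm hτ]) (by simp)]
    simp only [if_true]
    conv_lhs => rw [Matrix.matrix_eq_sum_single (Y τ')]
    refine Finset.sum_congr rfl fun a _ ↦ Finset.sum_congr rfl fun c _ ↦ ?_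
    rw [Matrix.smul_single, smul_eq_mul, mul_one]
  rw [hY]
  refine Submodule.sum_mem _ fun τ _ ↦ Submodule.sum_mem _ fun a _ ↦ Submodule.sum_mem _ fun c _ ↦
    Submodule.smul_mem _ _ (hrange (single_mem_span_emb τ a c))

/-- **The complexification of `𝔤𝔩ₙ(𝕜)` is `∏_τ 𝔤𝔩ₙ(ℂ)`**, basis form: for every real basis `b` of
`𝔤𝔩ₙ(𝕜)`, `(j(b_i))_i` is a complex basis of `∏_{τ : 𝕜 →ₐ[ℝ] ℂ} 𝔤𝔩ₙ(ℂ)`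
(Knapp 2002, §VI.1; Clozel 1990, §3.3). [folklore] -/
def embBasis {ι : Type*} (b : Module.Basis ι ℝ (Matrix (Fin n) (Fin n) 𝕜)) :
    Module.Basis ι ℂ ((𝕜 →ₐ[ℝ] ℂ) → Matrix (Fin n) (Fin n) ℂ) :=
  Module.Basis.mk (linearIndependent_emb_basis b) (span_emb_basis b)

/-- The complexified basis is `j ∘ b`. [folklore] -/
@[simp]
theorem embBasis_apply {ι : Type*} (b : Module.Basis ι ℝ (Matrix (Fin n) (Fin n) 𝕜)) (i : ι) :
    embBasis b i = embAlgHom 𝕜 n (b i) :=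
  Module.Basis.mk_apply _ _ i

end Embedding

/-! ### Complexification of the enveloping algebra: `ℂ ⊗_ℝ U(𝔤𝔩ₙ(𝕜)) ≅ U(∏_τ 𝔤𝔩ₙ(ℂ))` by PBW -/

section Envelope

variable (𝕜 n)

local notation "𝔤ℝ" => Matrix (Fin n) (Fin n) 𝕜
local notation "𝔤ℂ" => ((𝕜 →ₐ[ℝ] ℂ) → Matrix (Fin n) (Fin n) ℂ)
local notation "Uℝ" => UniversalEnvelopingAlgebra ℝ (Matrix (Fin n) (Fin n) 𝕜)
local notation "Uℂ" => UniversalEnvelopingAlgebra ℂ ((𝕜 →ₐ[ℝ] ℂ) → Matrix (Fin n) (Fin n) ℂ)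

/-- `j` followed by `ι : 𝔤_ℂ → U(𝔤_ℂ)`, a real Lie algebra homomorphism `𝔤𝔩ₙ(𝕜) → U(∏_τ 𝔤𝔩ₙ(ℂ))`.
[folklore] -/
def embLie : (Matrix (Fin n) (Fin n) 𝕜) →ₗ⁅ℝ⁆ Uℂ where
  toLinearMap := ((ι ℂ : 𝔤ℂ →ₗ⁅ℂ⁆ Uℂ).toLinearMap.restrictScalars ℝ) ∘ₗ (embAlgHom 𝕜 n).toLinearMap
  map_lie' := by
    intro X Y
    show ι ℂ (embAlgHom 𝕜 n ⁅X, Y⁆) = ⁅ι ℂ (embAlgHom 𝕜 n X), ι ℂ (embAlgHom 𝕜 n Y)⁆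
    rw [← AlgHom.toLieHom_apply, LieHom.map_lie, AlgHom.toLieHom_apply, AlgHom.toLieHom_apply, LieHom.map_lie]

/-- Unfolding of `embLie`: `X ↦ ι(j X)`. [folklore] -/
@[simp]
theorem embLie_apply (X : Matrix (Fin n) (Fin n) 𝕜) : embLie 𝕜 n X = ι ℂ (embAlgHom 𝕜 n X) := rfl

/-- The real algebra homomorphism `Φ : U(𝔤𝔩ₙ(𝕜)) → U(∏_τ 𝔤𝔩ₙ(ℂ))` induced by `j`. [folklore] -/
def envHom : Uℝ →ₐ[ℝ] Uℂ :=
  UniversalEnvelopingAlgebra.lift ℝ (embLie 𝕜 n)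

/-- `Φ (ι X) = ι (j X)` on generators. [folklore] -/
theorem envHom_ι (X : Matrix (Fin n) (Fin n) 𝕜) : envHom 𝕜 n (ι ℝ X) = ι ℂ (embAlgHom 𝕜 n X) :=
  lift_ι_apply ℝ _ X

/-- The complexification `Φ_ℂ : ℂ ⊗_ℝ U(𝔤𝔩ₙ(𝕜)) → U(∏_τ 𝔤𝔩ₙ(ℂ))`, `c ⊗ u ↦ c Φ(u)`. [folklore] -/
def envHomC : ℂ ⊗[ℝ] Uℝ →ₐ[ℂ] Uℂ :=
  Algebra.TensorProduct.lift (Algebra.ofId ℂ _) (envHom 𝕜 n) fun c _ ↦ Algebra.commutes c _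

/-- `Φ_ℂ (c ⊗ u) = c Φ(u)`. [folklore] -/
@[simp]
theorem envHomC_tmul (c : ℂ) (u : Uℝ) : envHomC 𝕜 n (c ⊗ₜ u) = c • envHom 𝕜 n u := by
  rw [envHomC, Algebra.TensorProduct.lift_tmul, Algebra.ofId_apply, Algebra.smul_def]

variable {𝕜 n}

/-- `Φ` maps words in a real basis to words in its complexified basis. [folklore] -/
theorem envHom_word {ι' : Type*} (b : Module.Basis ι' ℝ 𝔤ℝ) (l : List ι') :
    envHom 𝕜 n (Literature.Algebra.Lie.PBW.word b l) = Literature.Algebra.Lie.PBW.word (embBasis b) l := by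
  rw [Literature.Algebra.Lie.PBW.word, Literature.Algebra.Lie.PBW.word, map_list_prod, List.map_map]
  congr 1
  refine List.map_congr_left fun i _ ↦ ?_
  rw [Function.comp_apply, envHom_ι, embBasis_apply]

/-- `Φ` maps ordered monomials to ordered monomials. [folklore] -/
theorem envHom_ordMonomial {ι' : Type*} [LinearOrder ι'] (b : Module.Basis ι' ℝ 𝔤ℝ) (s : ι' →₀ ℕ) :
    envHom 𝕜 n (Literature.Algebra.Lie.PBW.ordMonomial b s) = Literature.Algebra.Lie.PBW.ordMonomial (embBasis b) s :=
  envHom_word b _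

variable (𝕜 n) in
/-- **`ℂ ⊗_ℝ U(𝔤𝔩ₙ(𝕜)) ≅ U(∏_τ 𝔤𝔩ₙ(ℂ))`**: the complexification `Φ_ℂ` is bijective, because it maps
the complexified PBW basis of `U(𝔤𝔩ₙ(𝕜))` (for any ordered real basis `b`) to the PBW basis of
`U(∏_τ 𝔤𝔩ₙ(ℂ))` for the complex basis `j ∘ b` (`Literature.Algebra.Lie.PBW.pbwBasis`). This is
`U(𝔤)_ℂ = U(𝔤_ℂ)` (Bourbaki, *Lie Groups and Lie Algebras* I §2.9, extension of the base ring;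
here deduced from PBW; cf. the design note `Z(𝔤_ℂ) = ℂ ⊗_ℝ Z(𝔤)` of `HarishChandraGL`).
[folklore] -/
theorem envHomC_bijective : Function.Bijective (envHomC 𝕜 n) := by
  classical
  let ι' := Module.Free.ChooseBasisIndex ℝ 𝔤ℝ
  let b : Module.Basis ι' ℝ 𝔤ℝ := Module.Free.chooseBasis ℝ 𝔤ℝ
  letI : LinearOrder ι' := WellOrderingRel.isWellOrder.linearOrder
  let B₁ : Module.Basis (ι' →₀ ℕ) ℂ (ℂ ⊗[ℝ] Uℝ) := Algebra.TensorProduct.basis ℂ (Literature.Algebra.Lie.PBW.pbwBasis b)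
  let B₂ : Module.Basis (ι' →₀ ℕ) ℂ Uℂ := Literature.Algebra.Lie.PBW.pbwBasis (embBasis b)
  have key : ∀ s, envHomC 𝕜 n (B₁ s) = B₂ s := by
    intro s
    rw [Algebra.TensorProduct.basis_apply, envHomC_tmul, one_smul, Literature.Algebra.Lie.PBW.pbwBasis_apply,
      Literature.Algebra.Lie.PBW.pbwBasis_apply, envHom_ordMonomial]
  have heq : (envHomC 𝕜 n).toLinearMap = (B₁.equiv B₂ (Equiv.refl _)).toLinearMap :=
    B₁.ext fun s ↦ by rw [AlgHom.toLinearMap_apply, key, LinearEquiv.coe_coe, Module.Basis.equiv_apply, Equiv.refl_apply]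
  have : Function.Bijective (envHomC 𝕜 n).toLinearMap := by
    rw [heq]
    exact (B₁.equiv B₂ _).bijective
  exact this

/-- `Φ_ℂ` is injective. [folklore] -/
theorem envHomC_injective : Function.Injective (envHomC 𝕜 n) := (envHomC_bijective 𝕜 n).1

/-- `Φ_ℂ` is surjective. [folklore] -/
theorem envHomC_surjective : Function.Surjective (envHomC 𝕜 n) := (envHomC_bijective 𝕜 n).2

/-! ### The centre of the complexification -/

/-- Real part of an element of `ℂ ⊗_ℝ M`: `c ⊗ m ↦ (re c) m`. [folklore] -/
def reT (M : Type*) [AddCommGroup M] [Module ℝ M] : ℂ ⊗[ℝ] M →ₗ[ℝ] M :=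
  TensorProduct.lift ((LinearMap.lsmul ℝ M).comp Complex.reLm)

/-- Imaginary part of an element of `ℂ ⊗_ℝ M`: `c ⊗ m ↦ (im c) m`. [folklore] -/
def imT (M : Type*) [AddCommGroup M] [Module ℝ M] : ℂ ⊗[ℝ] M →ₗ[ℝ] M :=
  TensorProduct.lift ((LinearMap.lsmul ℝ M).comp Complex.imLm)

/-- `re (c ⊗ m) = (re c) m`. [folklore] -/
@[simp]
theorem reT_tmul {M : Type*} [AddCommGroup M] [Module ℝ M] (c : ℂ) (m : M) : reT M (c ⊗ₜ m) = c.re • m := rfl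

/-- `im (c ⊗ m) = (im c) m`. [folklore] -/
@[simp]
theorem imT_tmul {M : Type*} [AddCommGroup M] [Module ℝ M] (c : ℂ) (m : M) : imT M (c ⊗ₜ m) = c.im • m := rfl

/-- `ζ = 1 ⊗ re ζ + i ⊗ im ζ` in `ℂ ⊗_ℝ M` (`ℂ = ℝ ⊕ ℝ i`). [folklore] -/
theorem tmul_reT_add_tmul_imT {M : Type*} [AddCommGroup M] [Module ℝ M] (ζ : ℂ ⊗[ℝ] M) :
    (1 : ℂ) ⊗ₜ reT M ζ + Complex.I ⊗ₜ imT M ζ = ζ := by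
  induction ζ using TensorProduct.induction_on with
  | zero => simp
  | tmul c m =>
    rw [reT_tmul, imT_tmul, TensorProduct.tmul_smul, TensorProduct.tmul_smul, TensorProduct.smul_tmul',
      TensorProduct.smul_tmul', ← TensorProduct.add_tmul]
    congr 1
    rw [Complex.real_smul, Complex.real_smul, mul_one, Complex.re_add_im]
  | add x y hx hy =>
    rw [map_add, map_add, TensorProduct.tmul_add, TensorProduct.tmul_add, add_add_add_comm, hx, hy]

/-- `re` and `im` of `(1 ⊗ u) ζ` and `ζ (1 ⊗ u)`. [folklore] -/
theorem reT_imT_mul (u : Uℝ) (ζ : ℂ ⊗[ℝ] Uℝ) :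
    reT _ (((1 : ℂ) ⊗ₜ u) * ζ) = u * reT _ ζ ∧ reT _ (ζ * ((1 : ℂ) ⊗ₜ u)) = reT _ ζ * u ∧
      imT _ (((1 : ℂ) ⊗ₜ u) * ζ) = u * imT _ ζ ∧ imT _ (ζ * ((1 : ℂ) ⊗ₜ u)) = imT _ ζ * u := by
  induction ζ using TensorProduct.induction_on with
  | zero => simp
  | tmul c v =>
    simp only [Algebra.TensorProduct.tmul_mul_tmul, one_mul, mul_one, reT_tmul, imT_tmul, mul_smul_comm,
      smul_mul_assoc, and_self]
  | add x y hx hy =>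
    simp only [mul_add, add_mul, map_add, hx.1, hy.1, hx.2.1, hy.2.1, hx.2.2.1, hy.2.2.1, hx.2.2.2, hy.2.2.2, and_self]

/-- **The centre of `ℂ ⊗_ℝ U`** comes from the centre of `U`: a central element of `ℂ ⊗_ℝ U(𝔤)` is
`1 ⊗ X + i ⊗ Y` with `X, Y ∈ Z(𝔤)`. [folklore] -/
theorem exists_of_mem_center_tensor {ζ : ℂ ⊗[ℝ] Uℝ} (hζ : ∀ u : Uℝ, ((1 : ℂ) ⊗ₜ u) * ζ = ζ * ((1 : ℂ) ⊗ₜ u)) :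
    ∃ X ∈ Subalgebra.center ℝ Uℝ, ∃ Y ∈ Subalgebra.center ℝ Uℝ, ζ = (1 : ℂ) ⊗ₜ X + Complex.I ⊗ₜ Y := by
  refine ⟨reT _ ζ, ?_, imT _ ζ, ?_, (tmul_reT_add_tmul_imT ζ).symm⟩
  · rw [Subalgebra.mem_center_iff]
    intro u
    have h := reT_imT_mul u ζ
    rw [← h.1, ← h.2.1, hζ u]
  · rw [Subalgebra.mem_center_iff]
    intro u
    have h := reT_imT_mul u ζ
    rw [← h.2.2.1, ← h.2.2.2, hζ u]

variable (𝕜 n)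

/-- `Φ_ℂ` restricted to `ℂ ⊗_ℝ Z(𝔤)`: `c ⊗ z ↦ c Φ(z)`. [folklore] -/
def centerHomC : ℂ ⊗[ℝ] Subalgebra.center ℝ Uℝ →ₐ[ℂ] Uℂ :=
  Algebra.TensorProduct.lift (Algebra.ofId ℂ _) ((envHom 𝕜 n).comp (Subalgebra.center ℝ Uℝ).val)
    fun c _ ↦ Algebra.commutes c _

/-- `Φ_ℂ (c ⊗ z) = c Φ(z)` for central `z`. [folklore] -/
@[simp]
theorem centerHomC_tmul (c : ℂ) (z : Subalgebra.center ℝ Uℝ) :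
    centerHomC 𝕜 n (c ⊗ₜ z) = c • envHom 𝕜 n (z : Uℝ) := by
  rw [centerHomC, Algebra.TensorProduct.lift_tmul, Algebra.ofId_apply, Algebra.smul_def]
  rfl

/-- `Φ_ℂ|_{ℂ ⊗ Z(𝔤)}` is `Φ_ℂ` precomposed with `ℂ ⊗ (Z(𝔤) ↪ U(𝔤))`. [folklore] -/
theorem centerHomC_eq_comp : centerHomC 𝕜 n =
    (envHomC 𝕜 n).comp (Algebra.TensorProduct.map (AlgHom.id ℂ ℂ) (Subalgebra.center ℝ Uℝ).val) := by
  refine Algebra.TensorProduct.ext' fun c z ↦ ?_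
  rw [centerHomC_tmul, AlgHom.comp_apply, Algebra.TensorProduct.map_tmul, envHomC_tmul]
  rfl

/-- `Φ_ℂ` is injective on `ℂ ⊗_ℝ Z(𝔤)` (`ℂ` is flat over `ℝ`). [folklore] -/
theorem centerHomC_injective : Function.Injective (centerHomC 𝕜 n) := by
  rw [centerHomC_eq_comp, AlgHom.coe_comp]
  refine (envHomC_injective (𝕜 := 𝕜) (n := n)).comp ?_
  intro x y hxy
  have hflat : Function.Injective ((Subalgebra.center ℝ Uℝ).val.toLinearMap.lTensor ℂ) :=
    Module.Flat.lTensor_preserves_injective_linearMap _ Subtype.val_injective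
  refine hflat ?_
  have h : ∀ ζ, ((Subalgebra.center ℝ Uℝ).val.toLinearMap.lTensor ℂ) ζ =
      Algebra.TensorProduct.map (AlgHom.id ℂ ℂ) (Subalgebra.center ℝ Uℝ).val ζ := fun ζ ↦ by
    induction ζ using TensorProduct.induction_on with
    | zero => simp
    | tmul c z => rfl
    | add x y hx hy => rw [map_add, map_add, hx, hy]
  rw [h, h]
  exact hxy

/-- `Φ_ℂ` maps `ℂ ⊗_ℝ Z(𝔤)` into the centre of `U(𝔤_ℂ)`. [folklore] -/
theorem centerHomC_mem_center (ζ : ℂ ⊗[ℝ] Subalgebra.center ℝ Uℝ) :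
    centerHomC 𝕜 n ζ ∈ Subalgebra.center ℂ Uℂ := by
  induction ζ using TensorProduct.induction_on with
  | zero => rw [map_zero]; exact zero_mem _
  | tmul c z =>
    rw [centerHomC_tmul]
    refine Subalgebra.smul_mem _ ?_ c
    rw [Subalgebra.mem_center_iff]
    intro w
    obtain ⟨ζ', rfl⟩ := envHomC_surjective (𝕜 := 𝕜) (n := n) w
    induction ζ' using TensorProduct.induction_on with
    | zero => simp
    | tmul c' u =>
      rw [envHomC_tmul, smul_mul_assoc, mul_smul_comm, ← map_mul, ← map_mul,
        Subalgebra.mem_center_iff.mp z.2 u]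
    | add x y hx hy => rw [map_add, add_mul, mul_add, hx, hy]
  | add x y hx hy => rw [map_add]; exact add_mem hx hy

/-- `Φ_ℂ` maps `ℂ ⊗_ℝ Z(𝔤)` onto the centre of `U(𝔤_ℂ)`: `Z(𝔤_ℂ) = ℂ ⊗_ℝ Z(𝔤)`. [folklore] -/
theorem exists_centerHomC_eq_of_mem_center {w : Uℂ} (hw : w ∈ Subalgebra.center ℂ Uℂ) :
    ∃ ζ, centerHomC 𝕜 n ζ = w := by
  obtain ⟨ζ₀, rfl⟩ := envHomC_surjective (𝕜 := 𝕜) (n := n) w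
  have hζ₀ : ∀ u : Uℝ, ((1 : ℂ) ⊗ₜ u) * ζ₀ = ζ₀ * ((1 : ℂ) ⊗ₜ u) := fun u ↦
    envHomC_injective (by rw [map_mul, map_mul, Subalgebra.mem_center_iff.mp hw])
  obtain ⟨X, hX, Y, hY, rfl⟩ := exists_of_mem_center_tensor hζ₀
  refine ⟨(1 : ℂ) ⊗ₜ ⟨X, hX⟩ + Complex.I ⊗ₜ ⟨Y, hY⟩, ?_⟩
  rw [map_add, centerHomC_tmul, centerHomC_tmul, map_add, envHomC_tmul, envHomC_tmul]

/-- **`Z(𝔤_ℂ) = ℂ ⊗_ℝ Z(𝔤)`**: the complex algebra isomorphism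
`Θ : ℂ ⊗_ℝ Z(U(𝔤𝔩ₙ(𝕜))) ≃ Z(U(∏_τ 𝔤𝔩ₙ(ℂ)))` (the identification used in the design of
`HarishChandraGL`, now a theorem). [folklore] -/
def centerEquiv : ℂ ⊗[ℝ] Subalgebra.center ℝ Uℝ ≃ₐ[ℂ] Subalgebra.center ℂ Uℂ :=
  AlgEquiv.ofBijective ((centerHomC 𝕜 n).codRestrict (Subalgebra.center ℂ Uℂ) (centerHomC_mem_center 𝕜 n))
    ⟨fun x y h ↦ centerHomC_injective 𝕜 n (congrArg Subtype.val h),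
      fun w ↦ by
        obtain ⟨ζ, hζ⟩ := exists_centerHomC_eq_of_mem_center 𝕜 n w.2
        exact ⟨ζ, Subtype.ext hζ⟩⟩

/-- `Θ ζ`, as an element of `U(𝔤_ℂ)`, is `Φ_ℂ ζ`. [folklore] -/
theorem coe_centerEquiv (ζ : ℂ ⊗[ℝ] Subalgebra.center ℝ Uℝ) :
    ((centerEquiv 𝕜 n ζ : Subalgebra.center ℂ Uℂ) : Uℂ) = centerHomC 𝕜 n ζ := rfl

end Envelope

/-! ### Restriction of complex representations to the real form -/

section Restriction

variable (𝕜 n)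

local notation "𝔤ℝ" => Matrix (Fin n) (Fin n) 𝕜
local notation "𝔤ℂ" => ((𝕜 →ₐ[ℝ] ℂ) → Matrix (Fin n) (Fin n) ℂ)
local notation "Uℝ" => UniversalEnvelopingAlgebra ℝ (Matrix (Fin n) (Fin n) 𝕜)
local notation "Uℂ" => UniversalEnvelopingAlgebra ℂ ((𝕜 →ₐ[ℝ] ℂ) → Matrix (Fin n) (Fin n) ℂ)

variable {𝕜 n}
variable {V : Type*} [AddCommGroup V] [Module ℂ V]

/-- The restriction of a complex representation `ρ` of `𝔤_ℂ = ∏_τ 𝔤𝔩ₙ(ℂ)` to the real form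
`𝔤𝔩ₙ(𝕜)` along `j`: a real Lie algebra representation on the complex space `V`. [folklore] -/
def resRep (ρ : 𝔤ℂ →ₗ⁅ℂ⁆ Module.End ℂ V) : 𝔤ℝ →ₗ⁅ℝ⁆ Module.End ℂ V where
  toFun X := ρ (embAlgHom 𝕜 n X)
  map_add' X Y := by rw [map_add, map_add]
  map_smul' c X := by
    rw [map_smul, ← algebraMap_smul ℂ c, map_smul, algebraMap_smul, RingHom.id_apply]
  map_lie' {X Y} := by
    show ρ (embAlgHom 𝕜 n ⁅X, Y⁆) = ⁅ρ (embAlgHom 𝕜 n X), ρ (embAlgHom 𝕜 n Y)⁆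
    rw [← AlgHom.toLieHom_apply, LieHom.map_lie, AlgHom.toLieHom_apply, AlgHom.toLieHom_apply,
      LieHom.map_lie]

/-- Unfolding of the restricted representation: `ρ|𝔤 (X) = ρ (j X)`. [folklore] -/
@[simp]
theorem resRep_apply (ρ : 𝔤ℂ →ₗ⁅ℂ⁆ Module.End ℂ V) (X : 𝔤ℝ) : resRep ρ X = ρ (embAlgHom 𝕜 n X) := rfl

/-- `U(𝔤𝔩ₙ(𝕜))` acts through `Φ`: `lift(ρ|𝔤) u = lift(ρ) (Φ u)`. [folklore] -/
theorem lift_resRep (ρ : 𝔤ℂ →ₗ⁅ℂ⁆ Module.End ℂ V) (u : Uℝ) :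
    lift ℝ (resRep ρ) u = lift ℂ ρ (envHom 𝕜 n u) := by
  have : lift ℝ (resRep ρ) = ((lift ℂ ρ).restrictScalars ℝ).comp (envHom 𝕜 n) := by
    refine UniversalEnvelopingAlgebra.hom_ext (h := LieHom.ext fun X ↦ ?_)
    simp only [LieHom.coe_comp, Function.comp_apply, AlgHom.coe_toLieHom, lift_ι_apply, AlgHom.coe_comp,
      AlgHom.coe_restrictScalars', envHom_ι, resRep_apply]
  exact congr($this u)

/-- A highest weight vector for `ρ` (complex form, `IsHighestWeightVectorC`) is a highest weight
vector for the restriction `ρ|𝔤𝔩ₙ(𝕜)` (real form, `IsHighestWeightVector`). [folklore] -/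
theorem isHighestWeightVector_resRep {ρ : 𝔤ℂ →ₗ⁅ℂ⁆ Module.End ℂ V} {l : ArchWeightGL 𝕜 n} {v : V}
    (hv : IsHighestWeightVectorC ρ l v) : IsHighestWeightVector (resRep ρ) l v := by
  refine ⟨hv.1, fun X hX ↦ ?_, fun h ↦ ?_⟩
  · rw [resRep_apply]
    refine hv.2.1 _ fun τ i j hij ↦ ?_
    rw [embAlgHom_apply, (mem_upperNilpLie_iff (𝕜 := 𝕜) (n := n) X).mp hX i j hij, map_zero]
  · rw [resRep_apply]
    have he : embAlgHom 𝕜 n (Matrix.diagonal h) =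
        fun τ : 𝕜 →ₐ[ℝ] ℂ ↦ Matrix.diagonal (fun i ↦ τ (h i)) := by
      funext τ
      ext a b
      rw [embAlgHom_apply, Matrix.diagonal_apply, Matrix.diagonal_apply]
      split_ifs <;> simp
    rw [he, hv.2.2]
    rfl

end Restriction

/-! ### Assembly: Harish-Chandra's isomorphism for the real form -/

section Main

variable (𝕜 n)

local notation "𝔤ℝ" => Matrix (Fin n) (Fin n) 𝕜
local notation "𝔤ℂ" => ((𝕜 →ₐ[ℝ] ℂ) → Matrix (Fin n) (Fin n) ℂ)
local notation "Uℝ" => UniversalEnvelopingAlgebra ℝ (Matrix (Fin n) (Fin n) 𝕜)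
local notation "Uℂ" => UniversalEnvelopingAlgebra ℂ ((𝕜 →ₐ[ℝ] ℂ) → Matrix (Fin n) (Fin n) ℂ)

/-- The `τ`-wise symmetric polynomials of `HarishChandraGL` are the block-symmetric polynomials of
`BlockSymmetric` (blocks indexed by `τ : 𝕜 →ₐ[ℝ] ℂ`). [folklore] -/
theorem symmetricSubalgebraGL_eq_blockSymmetricSubalgebra :
    symmetricSubalgebraGL 𝕜 n = Literature.RingTheory.MvPolynomial.BlockSymmetric.blockSymmetricSubalgebra (𝕜 →ₐ[ℝ] ℂ) n ℂ :=
  rfl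

variable {𝕜 n}

namespace HarishChandraHomGL

variable (γ : HarishChandraHomGL 𝕜 n)

/-- The easy inclusion in Harish-Chandra's theorem: the complexified Harish-Chandra homomorphism
takes values in the `∏_τ 𝔖ₙ`-symmetric polynomials (its range is the `ℂ`-span of the values
`γ z`, which are symmetric by the axiom `HarishChandraHomGL.symmetric`).
Knapp–Vogan 1995, Thm. 4.95, step `image(γ) ⊆ ℋ^W`. [folklore] -/
theorem range_liftBaseChange_le :
    LinearMap.range (γ.toAlgHom.toLinearMap.liftBaseChange ℂ) ≤
      Subalgebra.toSubmodule (symmetricSubalgebraGL 𝕜 n) := by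
  rw [LinearMap.range_liftBaseChange, Submodule.span_le]
  rintro _ ⟨z, rfl⟩
  exact γ.toAlgHom_mem_symmetricSubalgebraGL z

/-- The complexification `γ_ℂ : ℂ ⊗_ℝ Z(𝔤) →ₐ[ℂ] ℂ[x_{τ,i}]`, `c ⊗ z ↦ c · γ z`, of a
Harish-Chandra homomorphism, as a `ℂ`-algebra homomorphism. [folklore] -/
def baseChange : ℂ ⊗[ℝ] Subalgebra.center ℝ Uℝ →ₐ[ℂ] MvPolynomial ((𝕜 →ₐ[ℝ] ℂ) × Fin n) ℂ :=
  Algebra.TensorProduct.lift (Algebra.ofId ℂ _) γ.toAlgHom fun _ _ ↦ Commute.all _ _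

/-- `γ_ℂ (c ⊗ z) = c · γ z`. [folklore] -/
@[simp]
theorem baseChange_tmul (c : ℂ) (z : Subalgebra.center ℝ Uℝ) : γ.baseChange (c ⊗ₜ z) = c • γ.toAlgHom z := by
  rw [baseChange, Algebra.TensorProduct.lift_tmul, Algebra.ofId_apply, Algebra.smul_def]

/-- The `ℂ`-linear map underlying `γ.baseChange` is Mathlib's `liftBaseChange` of `γ`, the map
appearing in `harishChandraHomGL_bijective_symmetric`. [folklore] -/
theorem toLinearMap_baseChange : γ.baseChange.toLinearMap = γ.toAlgHom.toLinearMap.liftBaseChange ℂ := by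
  refine LinearMap.ext fun x ↦ ?_
  induction x using TensorProduct.induction_on with
  | zero => simp
  | add x y hx hy => rw [map_add, map_add, hx, hy]
  | tmul c z =>
    rw [AlgHom.toLinearMap_apply, baseChange_tmul, LinearMap.liftBaseChange_tmul]
    rfl

/-- The range of `γ.baseChange`, as a submodule, is the range of the linear map
`liftBaseChange ℂ γ`. [folklore] -/
theorem toSubmodule_range_baseChange :
    Subalgebra.toSubmodule γ.baseChange.range = LinearMap.range (γ.toAlgHom.toLinearMap.liftBaseChange ℂ) := by
  rw [← toLinearMap_baseChange]
  ext p
  simp only [Subalgebra.mem_toSubmodule, AlgHom.mem_range, LinearMap.mem_range, AlgHom.toLinearMap_apply]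

/-- `γ_ℂ` takes symmetric values. [folklore] -/
theorem baseChange_mem (ζ : ℂ ⊗[ℝ] Subalgebra.center ℝ Uℝ) : γ.baseChange ζ ∈ symmetricSubalgebraGL 𝕜 n := by
  induction ζ using TensorProduct.induction_on with
  | zero => rw [map_zero]; exact zero_mem _
  | tmul c z =>
    rw [baseChange_tmul]
    exact Subalgebra.smul_mem _ (γ.toAlgHom_mem_symmetricSubalgebraGL z) c
  | add x y hx hy => rw [map_add]; exact add_mem hx hy

/-- The Harish-Chandra homomorphism transported to the centre of the *complex* enveloping algebra
`Z(U(∏_τ 𝔤𝔩ₙ(ℂ)))` along `Θ : ℂ ⊗_ℝ Z(𝔤) ≃ Z(𝔤_ℂ)` (`centerEquiv`): `γ' = γ_ℂ ∘ Θ⁻¹`.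
[folklore] -/
def complexified : Subalgebra.center ℂ Uℂ →ₐ[ℂ] MvPolynomial ((𝕜 →ₐ[ℝ] ℂ) × Fin n) ℂ :=
  γ.baseChange.comp ((centerEquiv 𝕜 n).symm : Subalgebra.center ℂ Uℂ →ₐ[ℂ] ℂ ⊗[ℝ] Subalgebra.center ℝ Uℝ)

/-- `γ' (Θ ζ) = γ_ℂ ζ`. [folklore] -/
theorem complexified_centerEquiv (ζ : ℂ ⊗[ℝ] Subalgebra.center ℝ Uℝ) :
    γ.complexified (centerEquiv 𝕜 n ζ) = γ.baseChange ζ := by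
  rw [complexified, AlgHom.comp_apply, AlgEquiv.coe_toAlgHom, AlgEquiv.symm_apply_apply]

/-- `γ'` takes `∏_τ 𝔖ₙ`-symmetric (block-symmetric) values. [folklore] -/
theorem complexified_mem (w : Subalgebra.center ℂ Uℂ) :
    γ.complexified w ∈ Literature.RingTheory.MvPolynomial.BlockSymmetric.blockSymmetricSubalgebra (𝕜 →ₐ[ℝ] ℂ) n ℂ := by
  rw [← symmetricSubalgebraGL_eq_blockSymmetricSubalgebra]
  exact γ.baseChange_mem _

/-- **The highest weight property of `γ' = γ_ℂ ∘ Θ⁻¹` on complex representations**: every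
`w ∈ Z(U(𝔤_ℂ))` acts on a highest weight vector of weight `λ` of any complex representation of
`𝔤_ℂ = ∏_τ 𝔤𝔩ₙ(ℂ)` by `γ'(w)(λ + ρ)` — restrict the representation to the real form and use the
axiom `HarishChandraHomGL.highestWeight` on `Z(𝔤)`, then extend `ℂ`-linearly. [folklore] -/
theorem hasHWProperty_complexified [DecidableEq (𝕜 →ₐ[ℝ] ℂ)] :
    HCCore.HasHWProperty (fun p : (𝕜 →ₐ[ℝ] ℂ) × Fin n ↦ rhoGL n p.2) γ.complexified := by
  intro V _ _ ρ l v hv w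
  obtain ⟨ζ, rfl⟩ := (centerEquiv 𝕜 n).surjective w
  rw [complexified_centerEquiv, coe_centerEquiv]
  have hv' := isHighestWeightVector_resRep hv
  induction ζ using TensorProduct.induction_on with
  | zero => simp
  | tmul c z =>
    rw [centerHomC_tmul, baseChange_tmul, map_smul, map_smul, LinearMap.smul_apply, ← lift_resRep,
      γ.highestWeight V (resRep ρ) l v hv' z, smul_smul, smul_eq_mul]
  | add x y hx hy =>
    rw [map_add, map_add, map_add, map_add, LinearMap.add_apply, hx, hy, add_smul]

/-- **Harish-Chandra's isomorphism, complex form**: `γ' = γ_ℂ ∘ Θ⁻¹ : Z(U(𝔤_ℂ)) → ℂ[x_{τ,i}]` is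
injective with range the `∏_τ 𝔖ₙ`-symmetric polynomials (`HCCore.injective_and_range_eq_of_hasHWProperty`).
Knapp 2002, Thm. 5.44; Knapp–Vogan 1995, Thm. 4.95; Humphreys 1972, Thm. 23.3.
[cite: Knapp2002, §V.5 Thm. 5.44] -/
theorem complexified_injective_and_range_eq [DecidableEq (𝕜 →ₐ[ℝ] ℂ)] :
    Function.Injective γ.complexified ∧ γ.complexified.range = symmetricSubalgebraGL 𝕜 n :=
  HCCore.injective_and_range_eq_of_hasHWProperty γ.hasHWProperty_complexified γ.complexified_mem

/-- **Harish-Chandra's isomorphism** for `γ_ℂ : ℂ ⊗_ℝ Z(𝔤) → ℂ[x_{τ,i}]`: injective with range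
the `∏_τ 𝔖ₙ`-symmetric polynomials. [cite: Knapp2002, §V.5 Thm. 5.44] -/
theorem baseChange_injective_and_range_eq :
    Function.Injective γ.baseChange ∧ γ.baseChange.range = symmetricSubalgebraGL 𝕜 n := by
  classical
  obtain ⟨hinj, hrange⟩ := γ.complexified_injective_and_range_eq
  refine ⟨fun x y hxy ↦ (centerEquiv 𝕜 n).injective (hinj ?_), le_antisymm ?_ fun p hp ↦ ?_⟩
  · rwa [complexified_centerEquiv, complexified_centerEquiv]
  · rintro _ ⟨ζ, rfl⟩
    exact γ.baseChange_mem ζ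
  · rw [← hrange] at hp
    obtain ⟨w, rfl⟩ := hp
    obtain ⟨ζ, rfl⟩ := (centerEquiv 𝕜 n).surjective w
    exact ⟨ζ, (γ.complexified_centerEquiv ζ).symm⟩

end HarishChandraHomGL

/-- Restatement of `harishChandraHomGL_bijective_symmetric` in terms of the algebra map
`γ.baseChange`: it is injective with range the symmetric subalgebra. [folklore] -/
theorem harishChandraHomGL_bijective_symmetric_iff :
    harishChandraHomGL_bijective_symmetric (𝕜 := 𝕜) (n := n) ↔
      ∀ γ : HarishChandraHomGL 𝕜 n,
        Function.Injective γ.baseChange ∧ γ.baseChange.range = symmetricSubalgebraGL 𝕜 n := by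
  refine forall_congr' fun γ ↦ ?_
  have h1 : Function.Injective γ.baseChange ↔
      Function.Injective (γ.toAlgHom.toLinearMap.liftBaseChange ℂ) := by
    rw [← γ.toLinearMap_baseChange]
    rfl
  have h2 : γ.baseChange.range = symmetricSubalgebraGL 𝕜 n ↔
      LinearMap.range (γ.toAlgHom.toLinearMap.liftBaseChange ℂ) =
        Subalgebra.toSubmodule (symmetricSubalgebraGL 𝕜 n) := by
    rw [← γ.toSubmodule_range_baseChange, Subalgebra.toSubmodule_injective.eq_iff]
  rw [h1, h2]

/-- **Harish-Chandra's theorem (isomorphism) for `𝔤𝔩ₙ(𝕜)`, `𝕜 = ℝ` or `ℂ`** — the named fact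
`harishChandraHomGL_bijective_symmetric` holds: for every Harish-Chandra homomorphism `γ` (a real
algebra map `Z(𝔤) → ℂ[x_{τ,i}]` with `τ`-wise symmetric values computing the action of `Z(𝔤)` on
highest weight vectors at `λ + ρ`), the `ℂ`-linear extension `ℂ ⊗_ℝ Z(𝔤) → ℂ[x_{τ,i}]` is
injective with image exactly `ℂ[x_{τ,i}]^{∏_τ 𝔖ₙ}`. Proof: `Z(𝔤_ℂ) = ℂ ⊗_ℝ Z(𝔤)` by
Poincaré–Birkhoff–Witt (`centerEquiv`); on `Z(𝔤_ℂ)`, `γ_ℂ` has the highest weight property for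
all complex representations of `𝔤_ℂ = ∏_τ 𝔤𝔩ₙ(ℂ)`, hence equals the `ρ`-shifted Harish-Chandra
projection, which is injective (symmetrisation / `gr U = S(𝔤)`, torus invariance and Chevalley's
restriction theorem for `∏_τ 𝔤𝔩ₙ(ℂ)`) and — its values being symmetric — onto the symmetric
polynomials (Casimir elements `tr(𝔼_τ^k)` have Harish-Chandra symbols the power sums, which
generate; induction on the degree) (`HCCore.injective_and_range_eq_of_hasHWProperty`).
Knapp, *Lie Groups Beyond an Introduction* (2002), §V.5, Thm. 5.44; Knapp–Vogan (1995), Thm. 4.95;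
Humphreys (1972), §23.3; Bourbaki, *Lie* VIII §8.5 Thm. 2. [cite: Knapp2002, §V.5 Thm. 5.44] -/
theorem harishChandraHomGL_bijective_symmetric_holds :
    harishChandraHomGL_bijective_symmetric (𝕜 := 𝕜) (n := n) :=
  harishChandraHomGL_bijective_symmetric_iff.mpr fun γ ↦ γ.baseChange_injective_and_range_eq

end Main

end Literature.NumberTheory.Automorphic
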